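import Literature.AnabelianGeometry.EtaleTheta.FrobenioidThetaOfBiKummerData
import Literature.AnabelianGeometry.EtaleTheta.FrobenioidRootTransport
import Literature.AnabelianGeometry.EtaleTheta.Discharge.Sec5ModelCaseSlim

/-!
# [EtTh] §5 at the assembled data: the TRANSPORT binders `hT`, `hT′`, `hu`, `hYdd` of Thm. 5.6 at `ofBiKummerData` (pp. 329–335 / PDF pp. 103–109)

Mochizuki, *The étale theta function and its Frobenioid-theoretic manifestations*, Publ. RIMS **45** (2009), §5:
Thm. 5.7 p.329–330 (PDF pp.103–104) "the pair `(s^⊓_N, s^⊔_N)` is preserved … up to … a unit", Thm. 5.10 (ii)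
p.334 (PDF p.108), Prop. 2.4 p.264 (PDF p.38) [cite: MochizukiEtTh2009, Thm 5.7 p.329–330 (PDF pp.103–104)].

PROOF-ONLY (no definitions, no new named facts).  abc-iut cell, layer L2, row #2-R18 / RULINGS #6 (R52) of
abc-iut-L2-lead (prover abc-iut-w5-d245): the five TRANSPORT binders `{hT, hT′, hu, hstrv, hYdd}` of abc-iut-w5-d020's
`ThetaFrobenioid.cyclotomicRigidityPreserved_ofBiKummerData` (`Discharge/Sec5Thm56OfBiKummerData.lean`, p421202,
ll.63–71), read at abc-iut-L2-t4's assembled §5 data `ThetaFrobenioid.ofBiKummerData` (W3-L2-01).  CENSUS: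

* `hT`, `hT′`, `hu` — "`α⁻¹ ≫ Ψ(s^⊓_N) ≫ β = e ≫ s^⊓_N`", "`α⁻¹ ≫ Ψ(s^⊔_N) ≫ β = e ≫ s^⊔_N ≫ D_p`", "`D_p ∈ O^×(B_N)`" —
  are the Thm. 5.7 transport of the root NORMALISED to `D_c = 1`.  For ANY §5 data, the shape
  `(t^⊓, t^⊔) = (e ≫ s^⊓_N ≫ D_c, e ≫ s^⊔_N ≫ D_p)` with `D_c⁻¹·D_p ∈ O^×(B_N)` — which abc-iut-L2-d4 PROVES for model tempered
  Frobenioids (`exists_codTransport_of_div_eq_model`, [FrdI] Thm. 5.2 (ii) / 3.4 (ii)(v), layer L1) modulo Prop. 5.3 (vi) at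
  `A_N` (divisor matching for `e`) — yields `hT ∧ hT′ ∧ hu` for the re-normalised identification `β′ := β ≫ D_c⁻¹` of
  `Ψ(B_N)` with `B_N` (`capCupTransport_normalise`, pure bookkeeping; `β` is a free choice in p421202).  Hence AT THE DATA
  (`ofBiKummerData_pre : pre = ofModel … := rfl`): `exists_capCupTransport_ofBiKummerData` — `∃ β′ D_p, hT ∧ hT′ ∧ hu` from the
  model hypotheses (`ModelFrobenioid.Hypotheses`, base of FSM-type, "`Ψ` preserves base-equivalent pairs" — itself a THEOREM
  for a slim base with `Φ` non-dilating and `C` not group-like, `baseEquivalent_map_of_model`: variant `_slim`) and the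
  divisor-matching `e` (`hdivcap`/`hdivcup`, Prop. 5.3 (vi) — the binder every Thm. 5.7 discharge of the lineage carries).
* `hYdd` — "`θ(H_{B_N}) = H_{B_N}`", `H_{B_N} = ρ(Π^tp_Ÿ̲)` — is [EtTh] Prop. 2.4 ("`Π^tp_Ÿ̲ ⊆ Π^tp_X̲` is preserved by
  automorphisms") read through `ρ`: for ANY §5 data, if `θ` is the shadow on `Aut_D(B_N^bs)` of a (topological) automorphism
  `γ` of `Π^tp_X̲` (`θ ∘ ρ = ρ ∘ γ` — EXACTLY the binder `hγ` of p421202, abc-iut-w5-d013's printed relation) then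
  `θ(H_{B_N}) = H_{B_N}` follows from `γ(Π^tp_Ÿ̲) = Π^tp_Ÿ̲` (`HB_map_eq_of_galoisShadow`); at the data
  (`ofBiKummerData_HB/_ρ/_PiYdd : … := rfl`) this is `hYdd_ofBiKummerData_of_prop24`.  So `hYdd` is REDUCED to Prop. 2.4
  for the one automorphism `γ` (named fact of record `TemperedCoverData.Prop24`, FACT-LIST F-0609; binder family hP24 of
  GAP row G-L6d6-2) — an anabelian input, consumed BY NAME, not re-typed here.
* `hstrv` — Thm. 4.4 (iv) at the `N`-th root, `StrvTransport Ψ α e θ` — is NOT derivable at `ofBiKummerData` AS ASSEMBLED: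
  there `s^trv_N := σ` is a free PARAMETER section of `Aut_C(A_N) → Aut_D(A_N^bs)` (inputs `hσ`, `hdivc` only), and two
  sections differ by an arbitrary `O^×(A_N)`-valued cocycle, which `Ψ` need not fix up to ONE conjugation.  Print's `s^trv_N`
  "aris[es] from a base-Frobenius pair of `A_N` … completely determined … up to conjugation by an element of `O^×(A_N)`"
  ([FrdI] Prop. 5.6 — PROVED in layer L1: `PreFrobenioid.prop56_holds`); the derivation of `hstrv` therefore needs the EXTRA
  datum-level input «`σ` is a base-Frobenius pair of `A_N`» (`PreFrobenioid.IsBaseFrobeniusPairOfObj`) plus the transport of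
  base-Frobenius pairs along `(Ψ, Ψ^bs)` (L1 `BaseSectionImage` / Cor. 5.7) — recorded as GAP row G-w5d245-1 (decl wanted:
  `strvTransport_ofBiKummerData_of_isBaseFrobeniusPair`), NOT claimed here.  Typed ≠ proved for `hstrv`.

Nothing here asserts that the §5 data exist for an actual curve; no side is taken on [IUTchIII] Cor. 3.12.
-/

noncomputable section

namespace Literature.AnabelianGeometry.EtaleTheta

open CategoryTheory Opposite Literature.AlgebraicGeometry.Frobenioids

namespace ThetaFrobenioid

/-! ### Generic §5 data: normalisation `D_c = 1` and the Prop. 2.4 reduction of `hYdd` -/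

section Generic

universe w' v' v'' u' u''

variable {C : Type u'} [Category.{v'} C] {D : Type u''} [Category.{v''} D] (𝔉 : ThetaFrobenioid.{w'} C D)

/-- In `Aut_C(S)`, `(x⁻¹ · y).hom = y.hom ≫ x.inv` (Mathlib's `Aut` composes right-to-left). [folklore] -/
private theorem Aut_inv_mul_hom {S : C} (x y : Aut S) : (x⁻¹ * y).hom = y.hom ≫ x.inv := rfl

/-- `(1 : Aut_C(S)).hom = 𝟙 S`. [folklore] -/
private theorem Aut_one_hom (S : C) : (1 : Aut S).hom = 𝟙 S := rfl

/-- **Normalisation `D_c = 1` of the Thm. 5.7 transport** (p.329–330 (PDF pp.103–104); the shape consumed as `hT`, `hT′`,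
`hu` by `cyclotomicRigidityPreserved_ofBiKummerData`): if the transported pair is `(e ≫ s^⊓_N ≫ D_c, e ≫ s^⊔_N ≫ D_p)` with
`D_c⁻¹·D_p ∈ O^×(B_N)`, then for the re-normalised identification `β′ := β ≫ D_c⁻¹ : Ψ(B_N) ⥲ B_N` it is
`(e ≫ s^⊓_N, e ≫ s^⊔_N ≫ (D_c⁻¹·D_p))` with `D_c⁻¹·D_p` a unit.  [cite: MochizukiEtTh2009, Thm 5.7 p.329–330 (PDF pp.103–104)] -/
theorem capCupTransport_normalise {Ψ : C ≌ C} {α : Ψ.functor.obj 𝔉.AN ≅ 𝔉.AN} {β : Ψ.functor.obj 𝔉.BN ≅ 𝔉.BN}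
    {e : 𝔉.AN ≅ 𝔉.AN} {Dc Dp : Aut 𝔉.BN}
    (hc : α.inv ≫ Ψ.functor.map 𝔉.sCap ≫ β.hom = e.hom ≫ 𝔉.sCap ≫ Dc.hom)
    (hp : α.inv ≫ Ψ.functor.map 𝔉.sCup ≫ β.hom = e.hom ≫ 𝔉.sCup ≫ Dp.hom)
    (hu : Dc⁻¹ * Dp ∈ 𝔉.units 𝔉.BN) :
    α.inv ≫ Ψ.functor.map 𝔉.sCap ≫ (β ≪≫ Dc.symm).hom = e.hom ≫ 𝔉.sCap ≫ (1 : Aut 𝔉.BN).hom ∧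
      α.inv ≫ Ψ.functor.map 𝔉.sCup ≫ (β ≪≫ Dc.symm).hom = e.hom ≫ 𝔉.sCup ≫ (Dc⁻¹ * Dp).hom ∧
      Dc⁻¹ * Dp ∈ 𝔉.units 𝔉.BN := by
  have h1 : α.inv ≫ Ψ.functor.map 𝔉.sCap ≫ β.hom ≫ Dc.inv = e.hom ≫ 𝔉.sCap ≫ Dc.hom ≫ Dc.inv := by
    simpa only [Category.assoc] using congrArg (· ≫ Dc.inv) hc
  have h2 : α.inv ≫ Ψ.functor.map 𝔉.sCup ≫ β.hom ≫ Dc.inv = e.hom ≫ 𝔉.sCup ≫ Dp.hom ≫ Dc.inv := by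
    simpa only [Category.assoc] using congrArg (· ≫ Dc.inv) hp
  refine ⟨?_, ?_, hu⟩
  · rw [Iso.trans_hom, Iso.symm_hom, Aut_one_hom, Category.comp_id, h1, Iso.hom_inv_id, Category.comp_id]
  · rw [Iso.trans_hom, Iso.symm_hom, Aut_inv_mul_hom, h2]

/-- The same normalisation starting from abc-iut-L2-t4's `RootTransportWith Ψ α β e D_c D_p` (Thm. 5.7 at the root, witnesses
exposed) when the discrepancy is a unit (the `δ₃ = 1` case of "possible translation by an element of `l·ℤ`").
[cite: MochizukiEtTh2009, Thm 5.7 p.329–330 (PDF pp.103–104)] -/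
theorem capCupTransport_normalise_of_rootTransportWith {Ψ : C ≌ C} {α : Ψ.functor.obj 𝔉.AN ≅ 𝔉.AN}
    {β : Ψ.functor.obj 𝔉.BN ≅ 𝔉.BN} {e : 𝔉.AN ≅ 𝔉.AN} {Dc Dp : Aut 𝔉.BN}
    (h : 𝔉.RootTransportWith Ψ α β e Dc Dp) (hu : Dc⁻¹ * Dp ∈ 𝔉.units 𝔉.BN) :
    α.inv ≫ Ψ.functor.map 𝔉.sCap ≫ (β ≪≫ Dc.symm).hom = e.hom ≫ 𝔉.sCap ≫ (1 : Aut 𝔉.BN).hom ∧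
      α.inv ≫ Ψ.functor.map 𝔉.sCup ≫ (β ≪≫ Dc.symm).hom = e.hom ≫ 𝔉.sCup ≫ (Dc⁻¹ * Dp).hom ∧
      Dc⁻¹ * Dp ∈ 𝔉.units 𝔉.BN :=
  𝔉.capCupTransport_normalise h.1 h.2.1 hu

/-- **`hYdd` from Prop. 2.4** ([EtTh] Prop. 2.4 p.264 (PDF p.38): the subgroup `Π^tp_Ÿ̲ ⊆ Π^tp_X̲` is preserved by automorphisms of
`Π^tp_X̲`), generic form: if `θ ∈ Aut(Aut_D(B_N^bs))` is the `ρ`-shadow of an endomorphism `γ` of `Π^tp_X̲` (`θ ∘ ρ = ρ ∘ γ`) with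
`γ(Π^tp_Ÿ̲) = Π^tp_Ÿ̲`, then `θ(H_{B_N}) = H_{B_N}` for `H_{B_N} = ρ(Π^tp_Ÿ̲)`. [cite: MochizukiEtTh2009, Prop 2.4 p.264 (PDF p.38)] -/
theorem HB_map_eq_of_galoisShadow (θ : Aut (𝔉.base.obj 𝔉.BN) →* Aut (𝔉.base.obj 𝔉.BN)) (γ : 𝔉.PiX →* 𝔉.PiX)
    (hγ : ∀ y : 𝔉.PiX, θ (𝔉.ρ y) = 𝔉.ρ (γ y)) (hP24 : 𝔉.PiYdd.map γ = 𝔉.PiYdd) :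
    𝔉.HB.map θ = 𝔉.HB := by
  have hcomp : θ.comp 𝔉.ρ = 𝔉.ρ.comp γ := MonoidHom.ext hγ
  change (𝔉.PiYdd.map 𝔉.ρ).map θ = 𝔉.PiYdd.map 𝔉.ρ
  rw [Subgroup.map_map, hcomp, ← Subgroup.map_map, hP24]

/-- `hYdd` for a multiplicative EQUIVALENCE `θ` (the shape of p421202's binder `θΨ : Aut_D(B_N^bs) ≃* Aut_D(B_N^bs)`) and a
topological automorphism `γ` of `Π^tp_X̲`. [cite: MochizukiEtTh2009, Prop 2.4 p.264 (PDF p.38)] -/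
theorem HB_map_mulEquiv_eq_of_galoisShadow (θ : Aut (𝔉.base.obj 𝔉.BN) ≃* Aut (𝔉.base.obj 𝔉.BN))
    (γ : 𝔉.PiX ≃ₜ* 𝔉.PiX) (hγ : ∀ y : 𝔉.PiX, θ (𝔉.ρ y) = 𝔉.ρ (γ y))
    (hP24 : 𝔉.PiYdd.map γ.toMulEquiv.toMonoidHom = 𝔉.PiYdd) :
    𝔉.HB.map θ.toMonoidHom = 𝔉.HB :=
  𝔉.HB_map_eq_of_galoisShadow θ.toMonoidHom γ.toMulEquiv.toMonoidHom hγ hP24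

end Generic

/-! ### At the assembled data `ofBiKummerData` -/

section OfBiKummerData

universe u₀ v₀ u v w

variable {K : Type u₀} [Field K]
  {X : SemiGraphs.TemperedArithmeticGroup.{u₀} K} {D₀ : Type u₀} [Category.{v₀} D₀]
  {V : FrdIMonoidStub.{w}} {T₀ : RealifiedDivisorMonoids (D₀ := D₀) V} {D : Type u} [Category.{v} D]
  {VD : FrdICatStub.{u, v, w} D} {S : BiKummerSetting X T₀ D VD}
  {pullFrac : ∀ {A A' : S.C} (_ : A' ⟶ A), S.biratUnits A → S.biratUnits A'}
  {lv N : ℕ+} {T : ThetaEnvData.{max v w} N} {θ : S.biratUnits S.Aodot} {Bl : S.C}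
  {Pl : S.FractionPair θ Bl} {Rl : S.NthRoot θ Pl lv pullFrac}
  (h : ModelFrobenioid.Hypotheses S.tf.divisorMonoid S.tf.ratFnFunctor)
  (toB : ∀ A : S.C, S.biratUnits A →* S.tf.biratUnitsModel A) (Q : FrobenioidTheta.ThetaSubquotientStub.{w} D)
  (odd_l : Odd (lv : ℕ)) (R : S.NthRoot Rl.root Rl.pair N pullFrac) (ιX : T.PiX ≃ₜ* X.Pi)
  (hopen : IsOpen ((S.galoisSurj R.AN.base R.αData.isGalois).ker : Set X.Pi)) (σ : Aut R.AN.base →* Aut R.AN)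
  (K' : Type w) [Field K'] (constEmb : K'ˣ →* S.tf.biratUnitsModel R.BN)
  (constEmb_injective : Function.Injective constEmb)
  (hdivc : ∀ g : Aut R.BN.base,
    ModelFrobenioid.div ((σ ((BiKummerSetting.NthRoot.baseIso S R).conjAut.symm g)).hom ≫ R.pair.num) =
      ModelFrobenioid.div R.pair.num)
  (hdivp : ∀ y : T.PiYdd,
    ModelFrobenioid.div ((σ (S.galoisSurj R.AN.base R.αData.isGalois (ιX y.1))).hom ≫ R.pair.den) =
      ModelFrobenioid.div R.pair.den)

/-- **`hT ∧ hT′ ∧ hu` at the assembled §5 data** (Thm. 5.7 transport of `(s^⊓_N, s^⊔_N)`, normalised `D_c = 1`): for a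
self-equivalence `Ψ` of the model tempered Frobenioid preserving base-equivalent pairs ([FrdI] Thm. 3.4 (v)), identifications
`α, β`, and `e ∈ Aut_C(A_N)` matching the zero divisors of the transported sections (Prop. 5.3 (vi) at `A_N`), there are a
re-normalised `β′ = β ≫ D_c⁻¹` and a UNIT `D_p ∈ O^×(B_N)` with `α⁻¹ ≫ Ψ(s^⊓_N) ≫ β′ = e ≫ s^⊓_N`,
`α⁻¹ ≫ Ψ(s^⊔_N) ≫ β′ = e ≫ s^⊔_N ≫ D_p` — from abc-iut-L2-d4's `exists_codTransport_of_div_eq_model` ([FrdI] Thm. 5.2 (ii),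
3.4 (ii): layer L1, PROVED) at `ofBiKummerData_pre = rfl`. [cite: MochizukiEtTh2009, Thm 5.7 p.329–330 (PDF pp.103–104)] -/
theorem exists_capCupTransport_ofBiKummerData (hD : IsOfFSMType D)
    (Ψ : S.C ≌ S.C)
    (hbe : ∀ ⦃A A' : S.C⦄ (φ ψ : A ⟶ A'),
      (ofBiKummerData h toB Q odd_l R ιX hopen σ K' constEmb constEmb_injective hdivc hdivp).pre.BaseEquivalent φ ψ →
      (ofBiKummerData h toB Q odd_l R ιX hopen σ K' constEmb constEmb_injective hdivc hdivp).pre.BaseEquivalent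
        (Ψ.functor.map φ) (Ψ.functor.map ψ))
    (α : Ψ.functor.obj (ofBiKummerData h toB Q odd_l R ιX hopen σ K' constEmb constEmb_injective hdivc hdivp).AN ≅
      (ofBiKummerData h toB Q odd_l R ιX hopen σ K' constEmb constEmb_injective hdivc hdivp).AN)
    (β : Ψ.functor.obj (ofBiKummerData h toB Q odd_l R ιX hopen σ K' constEmb constEmb_injective hdivc hdivp).BN ≅
      (ofBiKummerData h toB Q odd_l R ιX hopen σ K' constEmb constEmb_injective hdivc hdivp).BN)
    (e : (ofBiKummerData h toB Q odd_l R ιX hopen σ K' constEmb constEmb_injective hdivc hdivp).AN ≅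
      (ofBiKummerData h toB Q odd_l R ιX hopen σ K' constEmb constEmb_injective hdivc hdivp).AN)
    (hdivcap : (ofBiKummerData h toB Q odd_l R ιX hopen σ K' constEmb constEmb_injective hdivc hdivp).pre.div
        (α.inv ≫ Ψ.functor.map (ofBiKummerData h toB Q odd_l R ιX hopen σ K' constEmb constEmb_injective hdivc hdivp).sCap ≫
          β.hom) =
      (ofBiKummerData h toB Q odd_l R ιX hopen σ K' constEmb constEmb_injective hdivc hdivp).pre.div
        (e.hom ≫ (ofBiKummerData h toB Q odd_l R ιX hopen σ K' constEmb constEmb_injective hdivc hdivp).sCap))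
    (hdivcup : (ofBiKummerData h toB Q odd_l R ιX hopen σ K' constEmb constEmb_injective hdivc hdivp).pre.div
        (α.inv ≫ Ψ.functor.map (ofBiKummerData h toB Q odd_l R ιX hopen σ K' constEmb constEmb_injective hdivc hdivp).sCup ≫
          β.hom) =
      (ofBiKummerData h toB Q odd_l R ιX hopen σ K' constEmb constEmb_injective hdivc hdivp).pre.div
        (e.hom ≫ (ofBiKummerData h toB Q odd_l R ιX hopen σ K' constEmb constEmb_injective hdivc hdivp).sCup)) :
    ∃ (Dc Dp : Aut (ofBiKummerData h toB Q odd_l R ιX hopen σ K' constEmb constEmb_injective hdivc hdivp).BN),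
      α.inv ≫ Ψ.functor.map (ofBiKummerData h toB Q odd_l R ιX hopen σ K' constEmb constEmb_injective hdivc hdivp).sCap ≫
          (β ≪≫ Dc.symm).hom =
        e.hom ≫ (ofBiKummerData h toB Q odd_l R ιX hopen σ K' constEmb constEmb_injective hdivc hdivp).sCap ≫
          (1 : Aut (ofBiKummerData h toB Q odd_l R ιX hopen σ K' constEmb constEmb_injective hdivc hdivp).BN).hom ∧
      α.inv ≫ Ψ.functor.map (ofBiKummerData h toB Q odd_l R ιX hopen σ K' constEmb constEmb_injective hdivc hdivp).sCup ≫
          (β ≪≫ Dc.symm).hom =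
        e.hom ≫ (ofBiKummerData h toB Q odd_l R ιX hopen σ K' constEmb constEmb_injective hdivc hdivp).sCup ≫ Dp.hom ∧
      Dp ∈ (ofBiKummerData h toB Q odd_l R ιX hopen σ K' constEmb constEmb_injective hdivc hdivp).units
        (ofBiKummerData h toB Q odd_l R ιX hopen σ K' constEmb constEmb_injective hdivc hdivp).BN := by
  obtain ⟨Dc, Dp, hc, hp, hu⟩ :=
    exists_codTransport_of_div_eq_model
      (𝔉 := ofBiKummerData h toB Q odd_l R ιX hopen σ K' constEmb constEmb_injective hdivc hdivp) Ψ α β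
      (ofBiKummerData_pre h toB Q odd_l R ιX hopen σ K' constEmb constEmb_injective hdivc hdivp) h hD hbe e hdivcap hdivcup
  exact ⟨Dc, Dc⁻¹ * Dp,
    (ofBiKummerData h toB Q odd_l R ιX hopen σ K' constEmb constEmb_injective hdivc hdivp).capCupTransport_normalise hc hp hu⟩

/-- The same with "`Ψ` preserves base-equivalent pairs" DISCHARGED by layer L1 for a slim base of FSM-type, `Φ` non-dilating and
`C` not of group-like type ([FrdI] Thm. 3.4 (v) via Prop. 5.1; [EtTh] Thm. 3.7 (i)(ii), Rmk. 3.7.2) — abc-iut-L2-d4's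
`baseEquivalent_map_of_model`. [cite: MochizukiEtTh2009, Thm 5.7 p.329–330 (PDF pp.103–104); Thm 3.7 p.305 (PDF p.79)] -/
theorem exists_capCupTransport_ofBiKummerData_slim (hD : IsOfFSMType D) (hslim : IsSlim D)
    (hnd : IsNonDilatingOn S.tf.divisorMonoid)
    (hN : ∃ A : S.C, ¬ (PreFrobenioidData.ofModel S.tf.divisorMonoid S.tf.ratFnFunctor S.tf.divBNatTrans).IsGroupLikeObj A)
    (Ψ : S.C ≌ S.C)
    (α : Ψ.functor.obj (ofBiKummerData h toB Q odd_l R ιX hopen σ K' constEmb constEmb_injective hdivc hdivp).AN ≅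
      (ofBiKummerData h toB Q odd_l R ιX hopen σ K' constEmb constEmb_injective hdivc hdivp).AN)
    (β : Ψ.functor.obj (ofBiKummerData h toB Q odd_l R ιX hopen σ K' constEmb constEmb_injective hdivc hdivp).BN ≅
      (ofBiKummerData h toB Q odd_l R ιX hopen σ K' constEmb constEmb_injective hdivc hdivp).BN)
    (e : (ofBiKummerData h toB Q odd_l R ιX hopen σ K' constEmb constEmb_injective hdivc hdivp).AN ≅
      (ofBiKummerData h toB Q odd_l R ιX hopen σ K' constEmb constEmb_injective hdivc hdivp).AN)
    (hdivcap : (ofBiKummerData h toB Q odd_l R ιX hopen σ K' constEmb constEmb_injective hdivc hdivp).pre.div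
        (α.inv ≫ Ψ.functor.map (ofBiKummerData h toB Q odd_l R ιX hopen σ K' constEmb constEmb_injective hdivc hdivp).sCap ≫
          β.hom) =
      (ofBiKummerData h toB Q odd_l R ιX hopen σ K' constEmb constEmb_injective hdivc hdivp).pre.div
        (e.hom ≫ (ofBiKummerData h toB Q odd_l R ιX hopen σ K' constEmb constEmb_injective hdivc hdivp).sCap))
    (hdivcup : (ofBiKummerData h toB Q odd_l R ιX hopen σ K' constEmb constEmb_injective hdivc hdivp).pre.div
        (α.inv ≫ Ψ.functor.map (ofBiKummerData h toB Q odd_l R ιX hopen σ K' constEmb constEmb_injective hdivc hdivp).sCup ≫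
          β.hom) =
      (ofBiKummerData h toB Q odd_l R ιX hopen σ K' constEmb constEmb_injective hdivc hdivp).pre.div
        (e.hom ≫ (ofBiKummerData h toB Q odd_l R ιX hopen σ K' constEmb constEmb_injective hdivc hdivp).sCup)) :
    ∃ (Dc Dp : Aut (ofBiKummerData h toB Q odd_l R ιX hopen σ K' constEmb constEmb_injective hdivc hdivp).BN),
      α.inv ≫ Ψ.functor.map (ofBiKummerData h toB Q odd_l R ιX hopen σ K' constEmb constEmb_injective hdivc hdivp).sCap ≫
          (β ≪≫ Dc.symm).hom =
        e.hom ≫ (ofBiKummerData h toB Q odd_l R ιX hopen σ K' constEmb constEmb_injective hdivc hdivp).sCap ≫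
          (1 : Aut (ofBiKummerData h toB Q odd_l R ιX hopen σ K' constEmb constEmb_injective hdivc hdivp).BN).hom ∧
      α.inv ≫ Ψ.functor.map (ofBiKummerData h toB Q odd_l R ιX hopen σ K' constEmb constEmb_injective hdivc hdivp).sCup ≫
          (β ≪≫ Dc.symm).hom =
        e.hom ≫ (ofBiKummerData h toB Q odd_l R ιX hopen σ K' constEmb constEmb_injective hdivc hdivp).sCup ≫ Dp.hom ∧
      Dp ∈ (ofBiKummerData h toB Q odd_l R ιX hopen σ K' constEmb constEmb_injective hdivc hdivp).units
        (ofBiKummerData h toB Q odd_l R ιX hopen σ K' constEmb constEmb_injective hdivc hdivp).BN :=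
  exists_capCupTransport_ofBiKummerData h toB Q odd_l R ιX hopen σ K' constEmb constEmb_injective hdivc hdivp hD Ψ
    (baseEquivalent_map_of_model
      (𝔉 := ofBiKummerData h toB Q odd_l R ιX hopen σ K' constEmb constEmb_injective hdivc hdivp)
      (ofBiKummerData_pre h toB Q odd_l R ιX hopen σ K' constEmb constEmb_injective hdivc hdivp) h hD hslim hnd hN Ψ)
    α β e hdivcap hdivcup

/-- **`hYdd` at the assembled §5 data from Prop. 2.4**: with `ρ = rhoOfBiKummerData` and `H_{B_N} = ρ(Π^tp_Ÿ̲)`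
(`ofBiKummerData_HB`), if `θ_Ψ` is the `ρ`-shadow of a topological automorphism `γ` of `Π^tp_X̲` (p421202's binder `hγ`) which
preserves `Π^tp_Ÿ̲` ([EtTh] Prop. 2.4 — the anabelian input, by name), then `θ_Ψ(H_{B_N}) = H_{B_N}` — LITERALLY the binder `hYdd`
of `cyclotomicRigidityPreserved_ofBiKummerData`. [cite: MochizukiEtTh2009, Prop 2.4 p.264 (PDF p.38); §5 p.331 (PDF p.105)] -/
theorem hYdd_ofBiKummerData_of_prop24
    (θΨ : Aut R.BN.base ≃* Aut R.BN.base) (γ : T.PiX ≃ₜ* T.PiX)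
    (hγ : ∀ y : T.PiX, θΨ (rhoOfBiKummerData R ιX y) = rhoOfBiKummerData R ιX (γ y))
    (hP24 : T.PiYdd.map γ.toMulEquiv.toMonoidHom = T.PiYdd) :
    (ofBiKummerData h toB Q odd_l R ιX hopen σ K' constEmb constEmb_injective hdivc hdivp).HB.map θΨ.toMonoidHom =
      (ofBiKummerData h toB Q odd_l R ιX hopen σ K' constEmb constEmb_injective hdivc hdivp).HB :=
  (ofBiKummerData h toB Q odd_l R ιX hopen σ K' constEmb constEmb_injective hdivc hdivp).HB_map_mulEquiv_eq_of_galoisShadow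
    θΨ γ hγ hP24

end OfBiKummerData

end ThetaFrobenioid

end Literature.AnabelianGeometry.EtaleTheta

end
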